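import Literature.AlgebraicGeometry.ShimuraVarieties.UnitaryBallConeCotangentForms
import Literature.AlgebraicGeometry.ShimuraVarieties.UnitaryBallUniformisationLocalSection
import Literature.AlgebraicGeometry.ShimuraVarieties.HermitianNegConeOrbitDensity
import HarnessLib

/-!
# A `ℂ`-linear 1-form of a compact unitary Shimura CURVE whose cone pull-back vanishes along the unitary group is zero (R6b)

Topic `AlgebraicGeometry/ShimuraVarieties`; namespace `Literature.AlgebraicGeometry.ShimuraVarieties.UnitaryBallUniformisationDatum`
(datum-dotted, as ★ `UnitaryBallConeCotangentForms` = M1).  THEOREMS ONLY (no definition, no named fact, no instance, no `sorry`).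
Cell `hodgecm-mathlib`, FLOOR-0 P5, crux `HLiu418`, line `F0_AlbCm`, sub-sub-line `F0_AlbCmS1Betti`, stub `stub_S1_levelRealisation`
(S1-R), leg R6b of A-p14 (g15)'s M5-rec design memo `DESIGN-M5rec` de7a71e3 §1 (I) ∕ §2 F3 (booked to F0P5-p01 (g0) by F0P5-plan (g0)
23:17:54Z).  HC_CM is proved only modulo the 7 printed citations until rung 0 closes; nothing printed is asserted here.

For `D : UnitaryBallUniformisationDatum p X`, a Hodge model `A` of `X`, `ψ := (X^an ≃ X(ℂ))⁻¹ ∘ unif : ℂ^{p+1} → X^an` (holomorphic on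
the negative cone, ★ M1 ∕ `UnitaryBallUniformisationLocalSection`):
* §1 `mfderiv_symm_comp_unif_surjective` (any `p`) — under LOCAL INJECTIVITY of `unif` modulo `ℂˣ` at `v` (the hypothesis `hinj` of ★
  `exists_mdifferentiableAt_section`, leg R6a) the real differential `dψ_v : ℂ^{p+1} → T_{ψ v} X^an` is SURJECTIVE (a holomorphic local
  section `σ` through `v` gives `dψ_v ∘ dσ = id`);
* §2 `mfderiv_symm_comp_unif_apply_smul_self` (any `p`) — `dψ_v (z • v) = 0` for every `z ∈ ℂ` (radial vanishing ★
  `mfderiv_symm_comp_unif_self` + `ℂ`-linearity of `dψ_v`, ★ `mfderiv_real_apply_smul`);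
* §3 `mfderiv_symm_comp_unif_apply_ne_zero` (`p = 1`) — hence `dψ_v s ≠ 0` for every `s ∉ ℂ v` (else `dψ_v` kills the basis `(v, s)` of
  `ℂ²`, contradicting §1 since `dim T X^an = 1`);
* §4 **`mform_eq_zero_of_forall_coneRead_unitary_eq_zero`** (`p = 1`, R6b) — a `ℂ`-LINEAR 1-form `α` of `X^an` whose cone read
  `g ↦ α_{ψ(g v₀)}(dψ_{g v₀}(g t₀))` (base vector `v₀` negative, direction `t₀ ∉ ℂ v₀`) vanishes at every `g ∈ U(Hℂ)(ℂ)` is ZERO: every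
  point of `X^an` is `ψ v` (`surjOn_unif`), `U(Hℂ)(ℂ)` moves `ℂ v₀` to `ℂ v` (Witt, ★ `exists_unitary_mulVec_eq_smul_of_mem_negCone`),
  homogeneity ★ `mfderiv_symm_comp_unif_smul` rescales, §3 makes the one realised tangent vector span `T_{ψ v}`, and `ℂ`-linearity finishes.
This is the injectivity of «holomorphic 1-form ↦ cone function on the group» for the disc quotients `Γ_q\𝔻` of the record curve
([Borel1997, §5.14]: the dictionary forms ↔ functions on the group is injective; [VoisinHodgeI2002, §2.2.1]).

## References
* [Borel1997] A. Borel, *Automorphic forms on SL₂(ℝ)* (1997), §5.13–§5.14.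
* [VoisinHodgeI2002] C. Voisin, *Hodge Theory and Complex Algebraic Geometry I* (2002), §2.2.1 (holomorphic maps, real and complex differentials).
* [BergeronMillsonMoeglin2016Balls] N. Bergeron, J. Millson, C. Moeglin, Acta Math. 216 (2016), Part 2 §1.3 (negative cone, transitivity).
-/

set_option autoImplicit false

noncomputable section

open Matrix Function
open scoped Manifold Topology
open Literature.Geometry.Kaehler (MForm)
open Literature.NumberTheory.Transcendental
open Literature.AlgebraicGeometry.HodgeTheory (HodgeModel)
open Literature.AlgebraicGeometry.Motives (SchemeOver ComplexPoints AlgPoints)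

namespace Literature.AlgebraicGeometry.ShimuraVarieties

namespace UnitaryBallUniformisationDatum

/-! ### §1 Surjectivity of `dψ_v` from a holomorphic local section (any rank) -/

section AnyRank

variable {p : ℕ} {X : SchemeOver ℂ} (D : UnitaryBallUniformisationDatum p X) (A : HodgeModel p X)

/-- `ψ ∘ σ = id` for a local section `σ` of `unif` read in the Hodge model: `ψ (σ y) = y` whenever `unif (σ y) = A.toComplexPoints y`.
[cite: VoisinHodgeI2002, §2.2.1] -/
theorem symm_comp_unif_apply_of_unif_eq {σ : A.carrier → (Fin (p + 1) → ℂ)} {y : A.carrier}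
    (h : D.unif (σ y) = A.toComplexPoints y) :
    (⇑A.isAnalytification.homeomorph.symm ∘ D.unif) (σ y) = y := by
  show A.isAnalytification.homeomorph.symm (D.unif (σ y)) = y
  rw [h]
  exact A.isAnalytification.homeomorph.symm_apply_apply y

/-- **`dψ_v` is surjective** under local injectivity of `unif` modulo `ℂˣ` at the cone point `v`: a holomorphic local section `σ` through `v`
(★ `exists_mdifferentiableAt_section`) satisfies `ψ ∘ σ = id` near `ψ v`, so `dψ_v ∘ dσ_{ψ v} = id`. [cite: VoisinHodgeI2002, §2.2.1] -/
theorem mfderiv_symm_comp_unif_surjective {v : Fin (p + 1) → ℂ} (hv : v ∈ D.cone)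
    (hinj : ∃ U : Set (Fin (p + 1) → ℂ), IsOpen U ∧ v ∈ U ∧
      ∀ v' ∈ U, ∀ w ∈ U, v' ∈ D.cone → w ∈ D.cone → D.unif v' = D.unif w → ∃ c : ℂ, v' = c • w) :
    Function.Surjective
      (mfderiv 𝓘(ℝ, Fin (p + 1) → ℂ) 𝓘(ℝ, A.model) (⇑A.isAnalytification.homeomorph.symm ∘ D.unif) v) := by
  set ψ : (Fin (p + 1) → ℂ) → A.carrier := ⇑A.isAnalytification.homeomorph.symm ∘ D.unif with hψ
  obtain ⟨W, σ, hWo, hyW, hσy, hσW, hσd⟩ := D.exists_mdifferentiableAt_section A hv hinj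
  set y : A.carrier := A.isAnalytification.homeomorph.symm (D.unif v) with hy
  -- `ψ ∘ σ = id` on `W`
  have hsec : ∀ y' ∈ W, (ψ ∘ σ) y' = y' := fun y' hy' =>
    D.symm_comp_unif_apply_of_unif_eq A (hσW y' hy').2
  have hev : (ψ ∘ σ) =ᶠ[𝓝 y] id := by
    filter_upwards [hWo.mem_nhds hyW] with y' hy' using hsec y' hy'
  have hdψ : MDifferentiableAt 𝓘(ℝ, Fin (p + 1) → ℂ) 𝓘(ℝ, A.model) ψ (σ y) := by
    rw [hσy]
    exact D.mdifferentiableAt_symm_comp_unif_real A hv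
  have hdσ : MDifferentiableAt 𝓘(ℝ, A.model) 𝓘(ℝ, Fin (p + 1) → ℂ) σ y := (hσd y hyW).real_of_complex
  have hcomp := mfderiv_comp y hdψ hdσ
  have hid : mfderiv 𝓘(ℝ, A.model) 𝓘(ℝ, A.model) (ψ ∘ σ) y = ContinuousLinearMap.id ℝ (TangentSpace 𝓘(ℝ, A.model) y) := by
    rw [hev.mfderiv_eq]
    exact mfderiv_id
  rw [hid, hσy] at hcomp
  intro w
  refine ⟨mfderiv 𝓘(ℝ, A.model) 𝓘(ℝ, Fin (p + 1) → ℂ) σ y w, ?_⟩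
  have h := ContinuousLinearMap.ext_iff.1 hcomp w
  exact h.symm

/-! ### §2 The complex radial directions are killed (any rank) -/

/-- `dψ_v (z • v) = 0` for every `z ∈ ℂ`: radial vanishing (★ `mfderiv_symm_comp_unif_self`) and `ℂ`-linearity of the real differential of
the holomorphic `ψ` (★ `mfderiv_real_apply_smul`). [cite: VoisinHodgeI2002, §2.2.1] [cite: BergeronMillsonMoeglin2016Balls, Part 2 §1.3] -/
theorem mfderiv_symm_comp_unif_apply_smul_self {v : Fin (p + 1) → ℂ} (hv : v ∈ D.cone) (z : ℂ) :
    mfderiv 𝓘(ℝ, Fin (p + 1) → ℂ) 𝓘(ℝ, A.model) (⇑A.isAnalytification.homeomorph.symm ∘ D.unif) v (z • v) = 0 := by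
  have h := mfderiv_real_apply_smul (D.mdifferentiableAt_symm_comp_unif_of_mem_cone A hv) z v
  rw [D.mfderiv_symm_comp_unif_self A hv] at h
  rw [h]
  show (z • (0 : A.model) : A.model) = (0 : A.model)
  exact smul_zero z

end AnyRank

/-! ### §3 Rank one: `dψ_v` kills exactly the line `ℂ v` -/

section RankOne

variable {X : SchemeOver ℂ} (D : UnitaryBallUniformisationDatum 1 X) (A : HodgeModel 1 X)

/-- A negative vector is non-zero. [cite: BergeronMillsonMoeglin2016Balls, Part 2 §1.3] -/
theorem ne_zero_of_mem_cone {q : ℕ} {Z : SchemeOver ℂ} (D' : UnitaryBallUniformisationDatum q Z) {v : Fin (q + 1) → ℂ}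
    (hv : v ∈ D'.cone) : v ≠ 0 := by
  rintro rfl
  rw [mem_negCone_iff] at hv
  simp at hv

/-- `v` negative and `s ∉ ℂ v` form a basis of `ℂ²`: every `x` is `a • v + b • s`. [folklore] -/
private theorem exists_eq_add_smul_of_not_mem_line {v s : Fin 2 → ℂ} (hv0 : v ≠ 0) (hs : ∀ c : ℂ, s ≠ c • v) (x : Fin 2 → ℂ) :
    ∃ a b : ℂ, x = a • v + b • s := by
  have hli : LinearIndependent ℂ ![v, s] := by
    rw [LinearIndependent.pair_iff]
    intro a b hab
    by_cases hb : b = 0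
    · subst hb
      rw [zero_smul, add_zero] at hab
      exact ⟨(smul_eq_zero.1 hab).resolve_right hv0, rfl⟩
    · exfalso
      apply hs (-(b⁻¹ * a))
      have hbs : b • s = -(a • v) := eq_neg_of_add_eq_zero_right hab
      calc s = b⁻¹ • (b • s) := by rw [smul_smul, inv_mul_cancel₀ hb, one_smul]
        _ = -(b⁻¹ * a) • v := by rw [hbs, smul_neg, smul_smul, neg_smul]
  have hspan : Submodule.span ℂ (Set.range ![v, s]) = ⊤ :=
    hli.span_eq_top_of_card_eq_finrank (by simp)
  have hx : x ∈ Submodule.span ℂ (Set.range ![v, s]) := by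
    rw [hspan]
    exact Submodule.mem_top
  obtain ⟨c, hc⟩ := (Submodule.mem_span_range_iff_exists_fun ℂ).1 hx
  refine ⟨c 0, c 1, ?_⟩
  rw [← hc, Fin.sum_univ_two]
  rfl

/-- **`p = 1`: `dψ_v s ≠ 0` for `s ∉ ℂ v`** (under local injectivity at `v`): otherwise `dψ_v` kills the basis `(v, s)` of `ℂ²` (§2), hence
vanishes, contradicting its surjectivity onto the 1-dimensional `T_{ψ v} X^an` (§1; `dim = 1` by `IsAnalytification.finrank_eq`).
[cite: VoisinHodgeI2002, §2.2.1] -/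
theorem mfderiv_symm_comp_unif_apply_ne_zero {v s : Fin 2 → ℂ} (hv : v ∈ D.cone)
    (hinj : ∃ U : Set (Fin 2 → ℂ), IsOpen U ∧ v ∈ U ∧
      ∀ v' ∈ U, ∀ w ∈ U, v' ∈ D.cone → w ∈ D.cone → D.unif v' = D.unif w → ∃ c : ℂ, v' = c • w)
    (hs : ∀ c : ℂ, s ≠ c • v) :
    mfderiv 𝓘(ℝ, Fin 2 → ℂ) 𝓘(ℝ, A.model) (⇑A.isAnalytification.homeomorph.symm ∘ D.unif) v s ≠ 0 := by
  intro hs0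
  have hsurj := D.mfderiv_symm_comp_unif_surjective A hv hinj
  -- `dψ_v` vanishes identically
  have hzero : ∀ x : Fin 2 → ℂ,
      mfderiv 𝓘(ℝ, Fin 2 → ℂ) 𝓘(ℝ, A.model) (⇑A.isAnalytification.homeomorph.symm ∘ D.unif) v x = 0 := by
    intro x
    obtain ⟨a, b, rfl⟩ := exists_eq_add_smul_of_not_mem_line (ne_zero_of_mem_cone D hv) hs x
    have hadd := (mfderiv 𝓘(ℝ, Fin 2 → ℂ) 𝓘(ℝ, A.model) (⇑A.isAnalytification.homeomorph.symm ∘ D.unif) v).map_add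
      (a • v) (b • s)
    have h1 := D.mfderiv_symm_comp_unif_apply_smul_self A hv a
    have h2 := mfderiv_real_apply_smul (D.mdifferentiableAt_symm_comp_unif_of_mem_cone A hv) b s
    rw [hs0] at h2
    refine hadd.trans ?_
    rw [h1, h2, zero_add]
    show (b • (0 : A.model) : A.model) = (0 : A.model)
    exact smul_zero b
  -- but `T_{ψ v} X^an = A.model` is 1-dimensional and `dψ_v` is onto
  have hfr : Module.finrank ℂ A.model = 1 := A.isAnalytification.finrank_eq
  obtain ⟨w, hw⟩ := (Module.finrank_pos_iff_exists_ne_zero (R := ℂ) (M := A.model)).1 (by omega)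
  obtain ⟨x, hx⟩ := hsurj w
  exact hw (hx.symm.trans (hzero x))

/-! ### §4 R6b: a `ℂ`-linear 1-form whose cone read vanishes along `U(Hℂ)(ℂ)` is zero (`p = 1`) -/

/-- **R6b.**  Let `D` uniformise the complex CURVE `X` (`p = 1`), `A` a Hodge model, `α` a `ℂ`-LINEAR 1-form of `X^an`, `v₀` negative and
`t₀ ∉ ℂ v₀`.  Assume local injectivity of `unif` modulo `ℂˣ` at every cone point (leg R6a) and that the cone read of `α` VANISHES ALONG
THE UNITARY GROUP: `α_{ψ(g v₀)}(dψ_{g v₀}(g t₀)) = 0` for every `g ∈ GL₂(ℂ)` with `gᴴ Hℂ g = Hℂ`.  Then `α = 0`.  Proof: a point of `X^an` is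
`ψ v` (`surjOn_unif`); Witt moves `v₀` to `t • v` inside `U(Hℂ)(ℂ)` (★ `exists_unitary_mulVec_eq_smul_of_mem_negCone`); by homogeneity
(★ `symm_comp_unif_smul`, ★ `mfderiv_symm_comp_unif_smul`) the hypothesis at that `g` reads `α_{ψ v}(dψ_v s) = 0` with `s = t⁻¹ g t₀ ∉ ℂ v`;
`dψ_v s` spans the line `T_{ψ v} X^an` (§3), and `α_{ψ v}` is `ℂ`-linear. [cite: Borel1997, §5.13–§5.14] [cite: VoisinHodgeI2002, §2.2.1]
[cite: BergeronMillsonMoeglin2016Balls, Part 2 §1.3] -/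
theorem mform_eq_zero_of_forall_coneRead_unitary_eq_zero
    {α : MForm 𝓘(ℝ, A.model) A.carrier ℂ 1} (hα : IsComplexLinearForm α)
    (hinj : ∀ v ∈ D.cone, ∃ U : Set (Fin 2 → ℂ), IsOpen U ∧ v ∈ U ∧
      ∀ v' ∈ U, ∀ w ∈ U, v' ∈ D.cone → w ∈ D.cone → D.unif v' = D.unif w → ∃ c : ℂ, v' = c • w)
    {v₀ t₀ : Fin 2 → ℂ} (hv₀ : v₀ ∈ D.cone) (hvt : ∀ c : ℂ, t₀ ≠ c • v₀)
    (hzero : ∀ g : GL (Fin 2) ℂ, (g : Matrix (Fin 2) (Fin 2) ℂ)ᴴ * D.Hℂ * (g : Matrix (Fin 2) (Fin 2) ℂ) = D.Hℂ →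
      α ((⇑A.isAnalytification.homeomorph.symm ∘ D.unif) ((g : Matrix (Fin 2) (Fin 2) ℂ) *ᵥ v₀))
        (fun _ ↦ mfderiv 𝓘(ℝ, Fin 2 → ℂ) 𝓘(ℝ, A.model) (⇑A.isAnalytification.homeomorph.symm ∘ D.unif)
          ((g : Matrix (Fin 2) (Fin 2) ℂ) *ᵥ v₀) ((g : Matrix (Fin 2) (Fin 2) ℂ) *ᵥ t₀)) = 0) :
    α = 0 := by
  funext y
  ext w
  -- a cone point over `y`
  obtain ⟨v, hv, hvy⟩ := D.surjOn_unif (Set.mem_univ (A.toComplexPoints y))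
  have hψv : (⇑A.isAnalytification.homeomorph.symm ∘ D.unif) v = y := by
    show A.isAnalytification.homeomorph.symm (D.unif v) = y
    rw [hvy]
    exact A.isAnalytification.homeomorph.symm_apply_apply y
  -- Witt: `g v₀ = t • v`, `g` unitary, `t > 0`
  obtain ⟨g, hg, t, ht, hgv⟩ := exists_unitary_mulVec_eq_smul_of_mem_negCone D.isHermitian_Hℂ hv₀ hv
  have htc : (t : ℂ) ≠ 0 := Complex.ofReal_ne_zero.mpr ht.ne'
  -- the realised tangent vector at `y`: `dψ_v s`, `s = t⁻¹ • g t₀`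
  set s : Fin 2 → ℂ := (t : ℂ)⁻¹ • ((g : Matrix (Fin 2) (Fin 2) ℂ) *ᵥ t₀) with hs_def
  have hgt : (g : Matrix (Fin 2) (Fin 2) ℂ) *ᵥ t₀ = (t : ℂ) • s := by
    rw [hs_def, smul_smul, mul_inv_cancel₀ htc, one_smul]
  have h0 : α y (fun _ ↦ mfderiv 𝓘(ℝ, Fin 2 → ℂ) 𝓘(ℝ, A.model) (⇑A.isAnalytification.homeomorph.symm ∘ D.unif) v s) = 0 := by
    have h := hzero g hg
    rw [hgv, hgt, D.mfderiv_symm_comp_unif_smul A htc hv s, D.symm_comp_unif_smul A htc hv, hψv] at h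
    exact h
  -- `s ∉ ℂ v`
  have hs : ∀ c : ℂ, s ≠ c • v := by
    intro c hsc
    apply hvt c
    -- `g t₀ = t • s = t • c • v = c • g v₀`, then cancel `g`
    have h1 : (g : Matrix (Fin 2) (Fin 2) ℂ) *ᵥ t₀ = (g : Matrix (Fin 2) (Fin 2) ℂ) *ᵥ (c • v₀) := by
      rw [Matrix.mulVec_smul, hgv, hgt, hsc]
      exact smul_comm _ _ _
    have h2 := congrArg (fun x => ((g⁻¹ : GL (Fin 2) ℂ) : Matrix (Fin 2) (Fin 2) ℂ) *ᵥ x) h1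
    have hginv : ((g⁻¹ : GL (Fin 2) ℂ) : Matrix (Fin 2) (Fin 2) ℂ) * (g : Matrix (Fin 2) (Fin 2) ℂ) = 1 := by
      rw [← Units.val_mul, inv_mul_cancel, Units.val_one]
    simp only [Matrix.mulVec_mulVec, hginv, Matrix.one_mulVec] at h2
    exact h2
  have hne := D.mfderiv_symm_comp_unif_apply_ne_zero A hv (hinj v hv) hs
  -- `α_y` is `ℂ`-linear on the line `T_y X^an = ℂ · dψ_v s` (read in the model space `A.model`)
  set u : A.model := mfderiv 𝓘(ℝ, Fin 2 → ℂ) 𝓘(ℝ, A.model) (⇑A.isAnalytification.homeomorph.symm ∘ D.unif) v s with hu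
  have hne' : u ≠ 0 := hne
  have hfr : Module.finrank ℂ A.model = 1 := A.isAnalytification.finrank_eq
  obtain ⟨c, hc⟩ := (finrank_eq_one_iff_of_nonzero' u hne').1 hfr (show A.model from w 0)
  have hw : w = fun _ ↦ (c • u : A.model) := by
    funext i
    rw [Subsingleton.elim i 0]
    exact hc.symm
  rw [hw, mform₁_apply_smul hα, h0, mul_zero]
  rfl

end RankOne

end UnitaryBallUniformisationDatum

end Literature.AlgebraicGeometry.ShimuraVarieties

end
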